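import Literature.Analysis.FluidPDE.NSFourierRestart
import Mathlib.Analysis.Calculus.BumpFunction.InnerProduct
import HarnessLib

/-!
# The Bourgain–Pavlović norm-inflation data on the Fourier side

Second support file for the discharge of the barrier
`Literature.Barriers.NavierStokesRegularity.CriticalBesovNormInflation` (Bourgain–Pavlović 2008,
Thm. 1.1: norm inflation for Navier–Stokes in `Ḃ^{-1}_{∞,∞}` from Schwartz data). Bourgain and
Pavlović choose the datum (their (3.1))
`u₀ = (Q/√r) ∑_{s ≤ r} |k_s| (v_s cos(k_s·x) + v'_s cos(k'_s·x))`, `k_s` lacunary and parallel,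
`k_s − k'_s = η` fixed, `v_s ⊥ k_s`, `v'_s ⊥ k'_s`: pairs of plane waves at very high, lacunary
frequencies whose quadratic interaction feeds the fixed low frequency `η`. Theorem 1.1 asserts a
Schwartz datum, which plane waves are not; this file realises the same geometry with **Schwartz
data**, on the Fourier side of the tree's pseudo-measure formulation (`NSFourierBilinear`,
`NSFourierRestart.FourierDatum`): each plane wave is replaced by a smooth bump of radius `ρ` in
frequency space around `±k_s`, `±k'_s`, and the polarisation vectors are the explicit
divergence-free polynomial fields `p(ξ) = (ξ₁, -ξ₀, 0)`, `q(ξ) = (0, -ξ₂, ξ₁)` (so that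
`ξ · p(ξ) = ξ · q(ξ) = 0` identically), which at the bump centres `k_s = N_s e₁`,
`k'_s = N_s e₁ − e₀` point along `e₀` and `e₂` respectively. Concretely

  `a₀(ξ)_l = i α ∑_{s < r} [ (ψ(ξ - k_s) + ψ(ξ + k_s)) p(ξ)_l + (ψ(ξ - k'_s) + ψ(ξ + k'_s)) q(ξ)_l ]`,

`α = Q/√r` the common amplitude, `N_s = 2^{n_s}` with gaps `n_{s+1} ≥ n_s + 3` (lacunarity) and
`N_0 ≥ 8`, `ψ` an even smooth bump supported in `‖ξ‖ < ρ ≤ 1/10`. The factor `i` and the oddness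
of `p`, `q` make `a₀(-ξ) = conj a₀(ξ)` (reality of the synthesis: the physical datum is a sum of
localised *sine* modes). This file provides the parameters (`InflationParams`), the datum
(`InflationParams.datum`) and its structural properties — continuity, smoothness, compact
support, every polynomial decay, the divergence-free symbol relation, conjugation symmetry —
packaged as a `FourierNS.FourierDatum` with viscosity `1` (`InflationParams.fourierDatum`), so that
the tree's Fourier–Picard pipeline (Leray's local regular solution, restartable;
`FourierDatum.isTaoSolutionOn`) applies to it, together with the free evolution
`InflationParams.free t ξ = e^{-4π²‖ξ‖²t} a₀(ξ)` and its elementary bounds.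

## References

* J. Bourgain, N. Pavlović, *Ill-posedness of the Navier–Stokes equations in a critical space in
  3D*, J. Funct. Anal. 255 (2008) 2233–2247, §3.1 (choice of initial data, (3.1)–(3.3)).
  [BourgainPavlovic2008]
-/

noncomputable section

open MeasureTheory Real Set Filter Topology Function Complex
open scoped ComplexConjugate ContDiff

namespace Literature.Analysis.FluidPDE.BourgainPavlovic

open FourierNS

/-- Local notation for frequency space `ℝ³ = EuclideanSpace ℝ (Fin 3)`. -/
local notation "E3" => EuclideanSpace ℝ (Fin 3)

/-! ### Parameters -/

/-- **Parameters of the norm-inflation data** (Bourgain–Pavlović 2008, §3.1): the bump radius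
`ρ ∈ (0, 1/10]`, the common amplitude `α > 0` (`= Q/√r` in BP's notation), the number of scales
`r`, and the dyadic exponents `n_s` of the scales `N_s = 2^{n_s}`, lacunary with gaps `≥ 3` and
`N_0 ≥ 8`. [cite: BourgainPavlovic2008, §3.1 (3.1)] -/
structure InflationParams where
  /-- the radius of the frequency bumps -/
  ρ : ℝ
  /-- positivity of the radius -/
  ρ_pos : 0 < ρ
  /-- the radius is at most `1/10` -/
  ρ_le : ρ ≤ 1 / 10
  /-- the common amplitude `α = Q/√r` -/
  α : ℝ
  /-- positivity of the amplitude -/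
  α_pos : 0 < α
  /-- the number of scales -/
  r : ℕ
  /-- the dyadic exponents of the scales -/
  n : ℕ → ℕ
  /-- the smallest scale is at least `2³` -/
  three_le_n : ∀ s, 3 ≤ n s
  /-- lacunarity: consecutive exponents differ by at least `3` -/
  n_gap : ∀ s, n s + 3 ≤ n (s + 1)

/-! ### Basis vectors, the low frequency and the polarisations -/

section Geometry

/-- The standard basis vector `e_i` of `ℝ³`. [folklore] -/
def e (i : Fin 3) : E3 := EuclideanSpace.single i 1

/-- Components of the basis vectors. [folklore] -/
@[simp]
theorem e_apply (i j : Fin 3) : e i j = if j = i then 1 else 0 := by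
  simp [e]

/-- `‖e_i‖ = 1`. [folklore] -/
@[simp]
theorem norm_e (i : Fin 3) : ‖e i‖ = 1 := by
  simp [e]

/-- The low frequency `η = e₀` fed by the interactions (Bourgain–Pavlović's `η ∈ 𝕊²`). [cite: BourgainPavlovic2008, §3.1 (3.2)] -/
def η : E3 := e 0

/-- Components of `η`. [folklore] -/
@[simp]
theorem η_apply (j : Fin 3) : η j = if j = 0 then 1 else 0 := by
  simp [η, e]

/-- `‖η‖ = 1`. [folklore] -/
@[simp]
theorem norm_η : ‖η‖ = 1 := norm_e 0

/-- **The first polarisation field** `p(ξ) = (ξ₁, -ξ₀, 0)` (`= ξ × e₂`; at `ξ = k_s = N_s e₁` it is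
`N_s e₀`), divergence free identically. [folklore] -/
def polP (ξ : E3) (l : Fin 3) : ℝ := ![ξ 1, -ξ 0, 0] l

/-- **The second polarisation field** `q(ξ) = (0, -ξ₂, ξ₁)` (`= e₀ × ξ`; at `ξ = k'_s = N_s e₁ − e₀`
it is `N_s e₂`), divergence free identically. [folklore] -/
def polQ (ξ : E3) (l : Fin 3) : ℝ := ![0, -ξ 2, ξ 1] l

/-- `ξ · p(ξ) = 0`. [folklore] -/
theorem sum_mul_polP (ξ : E3) : ∑ l, ξ l * polP ξ l = 0 := by
  simp [polP, Fin.sum_univ_three]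
  ring

/-- `ξ · q(ξ) = 0`. [folklore] -/
theorem sum_mul_polQ (ξ : E3) : ∑ l, ξ l * polQ ξ l = 0 := by
  simp [polQ, Fin.sum_univ_three]
  ring

/-- `p` is odd. [folklore] -/
theorem polP_neg (ξ : E3) (l : Fin 3) : polP (-ξ) l = -polP ξ l := by
  fin_cases l <;> simp [polP]

/-- `q` is odd. [folklore] -/
theorem polQ_neg (ξ : E3) (l : Fin 3) : polQ (-ξ) l = -polQ ξ l := by
  fin_cases l <;> simp [polQ]

/-- `|p(ξ)_l| ≤ ‖ξ‖`. [folklore] -/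
theorem abs_polP_le (ξ : E3) (l : Fin 3) : |polP ξ l| ≤ ‖ξ‖ := by
  fin_cases l
  · simpa [polP] using abs_apply_le_norm ξ 1
  · simpa [polP] using abs_apply_le_norm ξ 0
  · simp [polP]

/-- `|q(ξ)_l| ≤ ‖ξ‖`. [folklore] -/
theorem abs_polQ_le (ξ : E3) (l : Fin 3) : |polQ ξ l| ≤ ‖ξ‖ := by
  fin_cases l
  · simp [polQ]
  · simpa [polQ] using abs_apply_le_norm ξ 2
  · simpa [polQ] using abs_apply_le_norm ξ 1

/-- The components of `p` are continuous (linear). [folklore] -/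
theorem continuous_polP (l : Fin 3) : Continuous fun ξ : E3 => polP ξ l := by
  fin_cases l <;> simp [polP] <;> fun_prop

/-- The components of `q` are continuous (linear). [folklore] -/
theorem continuous_polQ (l : Fin 3) : Continuous fun ξ : E3 => polQ ξ l := by
  fin_cases l <;> simp [polQ] <;> fun_prop

/-- The components of `p` are smooth (linear). [folklore] -/
theorem contDiff_polP (l : Fin 3) : ContDiff ℝ ∞ fun ξ : E3 => polP ξ l := by
  fin_cases l <;> simp [polP] <;> fun_prop

/-- The components of `q` are smooth (linear). [folklore] -/
theorem contDiff_polQ (l : Fin 3) : ContDiff ℝ ∞ fun ξ : E3 => polQ ξ l := by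
  fin_cases l <;> simp [polQ] <;> fun_prop

end Geometry

namespace InflationParams

variable (d : InflationParams)

/-- The scales `N_s = 2^{n_s}`. [cite: BourgainPavlovic2008, §3.1] -/
def N (s : ℕ) : ℝ := (2 : ℝ) ^ d.n s

/-- `N_s > 0`. [folklore] -/
theorem N_pos (s : ℕ) : 0 < d.N s := pow_pos two_pos _

/-- `8 ≤ N_s`. [folklore] -/
theorem eight_le_N (s : ℕ) : 8 ≤ d.N s := by
  rw [N, show (8 : ℝ) = 2 ^ 3 by norm_num]
  exact pow_le_pow_right₀ one_le_two (d.three_le_n s)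

/-- `1 ≤ N_s`. [folklore] -/
theorem one_le_N (s : ℕ) : 1 ≤ d.N s := le_trans (by norm_num) (d.eight_le_N s)

/-- Lacunarity of the scales: `8 N_s ≤ N_{s+1}`. [cite: BourgainPavlovic2008, §3.1 ("very lacunary")] -/
theorem eight_mul_N_le (s : ℕ) : 8 * d.N s ≤ d.N (s + 1) := by
  rw [N, N, show (8 : ℝ) * 2 ^ d.n s = 2 ^ (d.n s + 3) by rw [pow_add]; norm_num; ring]
  exact pow_le_pow_right₀ one_le_two (d.n_gap s)

/-- The scales increase. [folklore] -/
theorem N_le_N_succ (s : ℕ) : d.N s ≤ d.N (s + 1) :=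
  le_trans (le_mul_of_one_le_left (d.N_pos s).le (by norm_num)) (d.eight_mul_N_le s)

/-- The scales are monotone. [folklore] -/
theorem N_mono : Monotone d.N := monotone_nat_of_le_succ d.N_le_N_succ

/-! ### The bump -/

/-- The frequency bump: Mathlib's smooth bump centred at `0` with inner radius `ρ/2` and outer
radius `ρ` (values in `[0,1]`, `= 1` on `‖ξ‖ ≤ ρ/2`, support the open ball of radius `ρ`,
even). [folklore] -/
def bump : ContDiffBump (0 : E3) := ⟨d.ρ / 2, d.ρ, by linarith [d.ρ_pos], by linarith [d.ρ_pos]⟩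

/-- The bump as a real function `ψ`. [folklore] -/
def ψ (ξ : E3) : ℝ := d.bump ξ

/-- `ψ ≥ 0`. [folklore] -/
theorem ψ_nonneg (ξ : E3) : 0 ≤ d.ψ ξ := d.bump.nonneg

/-- `ψ ≤ 1`. [folklore] -/
theorem ψ_le_one (ξ : E3) : d.ψ ξ ≤ 1 := d.bump.le_one

/-- `ψ` is even. [folklore] -/
theorem ψ_neg (ξ : E3) : d.ψ (-ξ) = d.ψ ξ := d.bump.neg ξ

/-- `ψ` is smooth. [folklore] -/
theorem contDiff_ψ : ContDiff ℝ ∞ d.ψ := d.bump.contDiff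

/-- `ψ` is continuous. [folklore] -/
theorem continuous_ψ : Continuous d.ψ := d.bump.continuous

/-- `ψ` vanishes outside the ball of radius `ρ`. [folklore] -/
theorem ψ_eq_zero {ξ : E3} (h : d.ρ ≤ ‖ξ‖) : d.ψ ξ = 0 := by
  apply d.bump.zero_of_le_dist
  simpa [bump] using h

/-- `ψ = 1` on the ball of radius `ρ/2`. [folklore] -/
theorem ψ_eq_one {ξ : E3} (h : ‖ξ‖ ≤ d.ρ / 2) : d.ψ ξ = 1 := by
  apply d.bump.one_of_mem_closedBall
  simpa [bump] using h

/-- Where `ψ ≠ 0` the frequency is within `ρ` of the origin. [folklore] -/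
theorem norm_lt_of_ψ_ne_zero {ξ : E3} (h : d.ψ ξ ≠ 0) : ‖ξ‖ < d.ρ :=
  not_le.1 fun h' => h (d.ψ_eq_zero h')

/-! ### The frequencies and the polarisations -/

/-- The high frequencies `k_s = N_s e₁` (all parallel; Bourgain–Pavlović's `k_s ∥ k₀`). [cite: BourgainPavlovic2008, §3.1] -/
def kvec (s : ℕ) : E3 := d.N s • e 1

/-- The companion frequencies `k'_s = k_s − η` (Bourgain–Pavlović's (3.2): `k_s − k'_s = η`). [cite: BourgainPavlovic2008, §3.1 (3.2)] -/
def kvec' (s : ℕ) : E3 := d.kvec s - η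

/-- `k_s − k'_s = η`. [cite: BourgainPavlovic2008, (3.2)] -/
theorem kvec_sub_kvec' (s : ℕ) : d.kvec s - d.kvec' s = η := by
  simp [kvec']

/-- Components of `k_s`. [folklore] -/
@[simp]
theorem kvec_apply (s : ℕ) (j : Fin 3) : d.kvec s j = if j = 1 then d.N s else 0 := by
  simp [kvec, e]

/-- Components of `k'_s`. [folklore] -/
theorem kvec'_apply (s : ℕ) (j : Fin 3) :
    d.kvec' s j = (if j = 1 then d.N s else 0) - (if j = 0 then 1 else 0) := by
  simp [kvec']

/-- `‖k_s‖ = N_s`. [folklore] -/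
@[simp]
theorem norm_kvec (s : ℕ) : ‖d.kvec s‖ = d.N s := by
  rw [kvec, norm_smul, norm_e, mul_one, Real.norm_of_nonneg (d.N_pos s).le]

/-- `N_s − 1 ≤ ‖k'_s‖`. [folklore] -/
theorem N_sub_one_le_norm_kvec' (s : ℕ) : d.N s - 1 ≤ ‖d.kvec' s‖ := by
  have h := norm_sub_norm_le (d.kvec s) η
  rw [norm_kvec, norm_η] at h
  rw [kvec']
  linarith [abs_sub_abs_le_abs_sub ‖d.kvec s‖ ‖η‖, norm_sub_norm_le (d.kvec s) η]

/-- `‖k'_s‖ ≤ N_s + 1`. [folklore] -/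
theorem norm_kvec'_le (s : ℕ) : ‖d.kvec' s‖ ≤ d.N s + 1 := by
  rw [kvec']
  calc ‖d.kvec s - η‖ ≤ ‖d.kvec s‖ + ‖η‖ := norm_sub_le _ _
    _ = d.N s + 1 := by rw [norm_kvec, norm_η]

/-! ### The bumps around the frequencies -/

/-- The symmetrised bump around `±k_s`: `B_s(ξ) = ψ(ξ - k_s) + ψ(ξ + k_s)`. [folklore] -/
def bumpK (s : ℕ) (ξ : E3) : ℝ := d.ψ (ξ - d.kvec s) + d.ψ (ξ + d.kvec s)

/-- The symmetrised bump around `±k'_s`: `B'_s(ξ) = ψ(ξ - k'_s) + ψ(ξ + k'_s)`. [folklore] -/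
def bumpK' (s : ℕ) (ξ : E3) : ℝ := d.ψ (ξ - d.kvec' s) + d.ψ (ξ + d.kvec' s)

/-- `B_s` is even. [folklore] -/
theorem bumpK_neg (s : ℕ) (ξ : E3) : d.bumpK s (-ξ) = d.bumpK s ξ := by
  rw [bumpK, bumpK, add_comm, show -ξ + d.kvec s = -(ξ - d.kvec s) by abel,
    show -ξ - d.kvec s = -(ξ + d.kvec s) by abel, d.ψ_neg, d.ψ_neg]

/-- `B'_s` is even. [folklore] -/
theorem bumpK'_neg (s : ℕ) (ξ : E3) : d.bumpK' s (-ξ) = d.bumpK' s ξ := by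
  rw [bumpK', bumpK', add_comm, show -ξ + d.kvec' s = -(ξ - d.kvec' s) by abel,
    show -ξ - d.kvec' s = -(ξ + d.kvec' s) by abel, d.ψ_neg, d.ψ_neg]

/-- `0 ≤ B_s ≤ 2`. [folklore] -/
theorem bumpK_nonneg (s : ℕ) (ξ : E3) : 0 ≤ d.bumpK s ξ := add_nonneg (d.ψ_nonneg _) (d.ψ_nonneg _)

/-- `0 ≤ B'_s`. [folklore] -/
theorem bumpK'_nonneg (s : ℕ) (ξ : E3) : 0 ≤ d.bumpK' s ξ := add_nonneg (d.ψ_nonneg _) (d.ψ_nonneg _)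

/-- `B_s ≤ 2`. [folklore] -/
theorem bumpK_le_two (s : ℕ) (ξ : E3) : d.bumpK s ξ ≤ 2 := by
  have := d.ψ_le_one (ξ - d.kvec s); have := d.ψ_le_one (ξ + d.kvec s)
  rw [bumpK]; linarith

/-- `B'_s ≤ 2`. [folklore] -/
theorem bumpK'_le_two (s : ℕ) (ξ : E3) : d.bumpK' s ξ ≤ 2 := by
  have := d.ψ_le_one (ξ - d.kvec' s); have := d.ψ_le_one (ξ + d.kvec' s)
  rw [bumpK']; linarith

/-- `B_s` is smooth. [folklore] -/
theorem contDiff_bumpK (s : ℕ) : ContDiff ℝ ∞ (d.bumpK s) :=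
  (d.contDiff_ψ.comp (contDiff_id.sub contDiff_const)).add
    (d.contDiff_ψ.comp (contDiff_id.add contDiff_const))

/-- `B'_s` is smooth. [folklore] -/
theorem contDiff_bumpK' (s : ℕ) : ContDiff ℝ ∞ (d.bumpK' s) :=
  (d.contDiff_ψ.comp (contDiff_id.sub contDiff_const)).add
    (d.contDiff_ψ.comp (contDiff_id.add contDiff_const))

/-- **Support of `B_s`**: where `B_s(ξ) ≠ 0`, `N_s − ρ < ‖ξ‖ < N_s + ρ`. [folklore] -/
theorem norm_bounds_of_bumpK_ne_zero {s : ℕ} {ξ : E3} (h : d.bumpK s ξ ≠ 0) :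
    d.N s - d.ρ < ‖ξ‖ ∧ ‖ξ‖ < d.N s + d.ρ := by
  rw [bumpK] at h
  have hcase : d.ψ (ξ - d.kvec s) ≠ 0 ∨ d.ψ (ξ + d.kvec s) ≠ 0 := by
    by_contra hc
    push Not at hc
    exact h (by rw [hc.1, hc.2, add_zero])
  rcases hcase with h1 | h1
  · have hlt := d.norm_lt_of_ψ_ne_zero h1
    constructor
    · have := norm_sub_norm_le (d.kvec s) ξ
      rw [norm_kvec, norm_sub_rev] at this
      linarith
    · have := norm_le_norm_add_norm_sub' ξ (d.kvec s)
      have h2 : ‖ξ‖ ≤ ‖ξ - d.kvec s‖ + ‖d.kvec s‖ := norm_le_norm_sub_add ξ (d.kvec s)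
      rw [norm_kvec] at h2
      linarith
  · have hlt := d.norm_lt_of_ψ_ne_zero h1
    constructor
    · have := norm_sub_norm_le (d.kvec s) (-ξ)
      rw [norm_kvec, norm_neg, show d.kvec s - -ξ = ξ + d.kvec s by abel] at this
      linarith
    · have h2 : ‖ξ‖ ≤ ‖ξ + d.kvec s‖ + ‖d.kvec s‖ := by
        simpa using norm_le_norm_sub_add ξ (-d.kvec s)
      rw [norm_kvec] at h2
      linarith

/-- **Support of `B'_s`**: where `B'_s(ξ) ≠ 0`, `N_s − 1 − ρ < ‖ξ‖ < N_s + 1 + ρ`. [folklore] -/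
theorem norm_bounds_of_bumpK'_ne_zero {s : ℕ} {ξ : E3} (h : d.bumpK' s ξ ≠ 0) :
    d.N s - 1 - d.ρ < ‖ξ‖ ∧ ‖ξ‖ < d.N s + 1 + d.ρ := by
  rw [bumpK'] at h
  have hlo := d.N_sub_one_le_norm_kvec' s
  have hhi := d.norm_kvec'_le s
  have hcase : d.ψ (ξ - d.kvec' s) ≠ 0 ∨ d.ψ (ξ + d.kvec' s) ≠ 0 := by
    by_contra hc
    push Not at hc
    exact h (by rw [hc.1, hc.2, add_zero])
  rcases hcase with h1 | h1
  · have hlt := d.norm_lt_of_ψ_ne_zero h1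
    constructor
    · have := norm_sub_norm_le (d.kvec' s) ξ
      rw [norm_sub_rev] at this
      linarith
    · have h2 : ‖ξ‖ ≤ ‖ξ - d.kvec' s‖ + ‖d.kvec' s‖ := norm_le_norm_sub_add ξ (d.kvec' s)
      linarith
  · have hlt := d.norm_lt_of_ψ_ne_zero h1
    constructor
    · have := norm_sub_norm_le (d.kvec' s) (-ξ)
      rw [norm_neg, show d.kvec' s - -ξ = ξ + d.kvec' s by abel] at this
      linarith
    · have h2 : ‖ξ‖ ≤ ‖ξ + d.kvec' s‖ + ‖d.kvec' s‖ := by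
        simpa using norm_le_norm_sub_add ξ (-d.kvec' s)
      linarith

/-- On the support of `B_s` or `B'_s`: `N_s − 2 < ‖ξ‖ < N_s + 2`. [folklore] -/
theorem norm_bounds_of_ne_zero {s : ℕ} {ξ : E3} (h : d.bumpK s ξ ≠ 0 ∨ d.bumpK' s ξ ≠ 0) :
    d.N s - 2 < ‖ξ‖ ∧ ‖ξ‖ < d.N s + 2 := by
  have hρ := d.ρ_le
  rcases h with h | h
  · have := d.norm_bounds_of_bumpK_ne_zero h
    constructor <;> linarith [this.1, this.2]
  · have := d.norm_bounds_of_bumpK'_ne_zero h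
    constructor <;> linarith [this.1, this.2]

/-! ### The datum -/

/-- **The scale-`s` piece of the datum** (real, before the factor `i`):
`c_s(ξ)_l = α (B_s(ξ) p(ξ)_l + B'_s(ξ) q(ξ)_l)`. [cite: BourgainPavlovic2008, (3.1)] -/
def piece (s : ℕ) (ξ : E3) (l : Fin 3) : ℝ :=
  d.α * (d.bumpK s ξ * polP ξ l + d.bumpK' s ξ * polQ ξ l)

/-- **The Bourgain–Pavlović datum on the Fourier side** (Schwartz-class realisation of (3.1)):
`a₀(ξ)_l = i ∑_{s < r} c_s(ξ)_l`. [cite: BourgainPavlovic2008, (3.1)] -/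
def datum (ξ : E3) (l : Fin 3) : ℂ := Complex.I * ∑ s ∈ Finset.range d.r, (d.piece s ξ l : ℂ)

/-- The pieces are odd. [folklore] -/
theorem piece_neg (s : ℕ) (ξ : E3) (l : Fin 3) : d.piece s (-ξ) l = -d.piece s ξ l := by
  simp only [piece, bumpK_neg, bumpK'_neg, polP_neg, polQ_neg]
  ring

/-- The pieces are smooth. [folklore] -/
theorem contDiff_piece (s : ℕ) (l : Fin 3) : ContDiff ℝ ∞ fun ξ => d.piece s ξ l :=
  contDiff_const.mul (((d.contDiff_bumpK s).mul (contDiff_polP l)).add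
    ((d.contDiff_bumpK' s).mul (contDiff_polQ l)))

/-- The pieces vanish off the shell `N_s − 2 < ‖ξ‖ < N_s + 2`. [folklore] -/
theorem piece_eq_zero {s : ℕ} {ξ : E3} (h : ‖ξ‖ ≤ d.N s - 2 ∨ d.N s + 2 ≤ ‖ξ‖) (l : Fin 3) :
    d.piece s ξ l = 0 := by
  have h1 : d.bumpK s ξ = 0 := by
    by_contra hc
    have := d.norm_bounds_of_ne_zero (Or.inl hc)
    rcases h with h | h <;> linarith [this.1, this.2]
  have h2 : d.bumpK' s ξ = 0 := by
    by_contra hc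
    have := d.norm_bounds_of_ne_zero (Or.inr hc)
    rcases h with h | h <;> linarith [this.1, this.2]
  simp [piece, h1, h2]

/-- **Size of the pieces**: `|c_s(ξ)_l| ≤ 2α (N_s + 2)` (bumps `≤ 2`, `|p|, |q| ≤ ‖ξ‖ < N_s + 2`
on the support, and the two bumps have disjoint... no: simply both terms bounded). More precisely
`|c_s(ξ)_l| ≤ α (B_s(ξ) + B'_s(ξ)) (N_s + 2)`. [folklore] -/
theorem abs_piece_le (s : ℕ) (ξ : E3) (l : Fin 3) :
    |d.piece s ξ l| ≤ d.α * ((d.bumpK s ξ + d.bumpK' s ξ) * (d.N s + 2)) := by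
  have hα := d.α_pos.le
  have hB := d.bumpK_nonneg s ξ
  have hB' := d.bumpK'_nonneg s ξ
  -- on the support `‖ξ‖ < N_s + 2`; off it everything vanishes
  by_cases hsupp : d.bumpK s ξ ≠ 0 ∨ d.bumpK' s ξ ≠ 0
  · have hξ := (d.norm_bounds_of_ne_zero hsupp).2
    have hp : |polP ξ l| ≤ d.N s + 2 := (abs_polP_le ξ l).trans hξ.le
    have hq : |polQ ξ l| ≤ d.N s + 2 := (abs_polQ_le ξ l).trans hξ.le
    rw [piece, abs_mul, abs_of_nonneg hα]
    refine mul_le_mul_of_nonneg_left ?_ hα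
    calc |d.bumpK s ξ * polP ξ l + d.bumpK' s ξ * polQ ξ l|
        ≤ |d.bumpK s ξ * polP ξ l| + |d.bumpK' s ξ * polQ ξ l| := abs_add_le _ _
      _ = d.bumpK s ξ * |polP ξ l| + d.bumpK' s ξ * |polQ ξ l| := by
          rw [abs_mul, abs_mul, abs_of_nonneg hB, abs_of_nonneg hB']
      _ ≤ d.bumpK s ξ * (d.N s + 2) + d.bumpK' s ξ * (d.N s + 2) := by gcongr
      _ = (d.bumpK s ξ + d.bumpK' s ξ) * (d.N s + 2) := by ring
  · push Not at hsupp
    rw [piece, hsupp.1, hsupp.2]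
    simp only [zero_mul, add_zero, mul_zero, abs_zero]
    positivity

/-- Crude size of the pieces: `|c_s(ξ)_l| ≤ 4α (N_s + 2)`. [folklore] -/
theorem abs_piece_le' (s : ℕ) (ξ : E3) (l : Fin 3) : |d.piece s ξ l| ≤ 4 * d.α * (d.N s + 2) := by
  refine (d.abs_piece_le s ξ l).trans ?_
  have h1 := d.bumpK_le_two s ξ
  have h2 := d.bumpK'_le_two s ξ
  have hN := (d.N_pos s).le
  have hα := d.α_pos.le
  calc d.α * ((d.bumpK s ξ + d.bumpK' s ξ) * (d.N s + 2))
      ≤ d.α * ((2 + 2) * (d.N s + 2)) := by gcongr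
    _ = 4 * d.α * (d.N s + 2) := by ring

/-- Components of the datum. [folklore] -/
theorem datum_apply (ξ : E3) (l : Fin 3) :
    d.datum ξ l = Complex.I * ∑ s ∈ Finset.range d.r, (d.piece s ξ l : ℂ) := rfl

/-- **Conjugation symmetry** `a₀(-ξ) = conj a₀(ξ)` (the pieces are real and odd, the prefactor
is `i`): the synthesized datum is a real vector field. [folklore] -/
theorem datum_conj_symm (ξ : E3) (l : Fin 3) : d.datum (-ξ) l = conj (d.datum ξ l) := by
  simp only [datum_apply, piece_neg, Complex.ofReal_neg, Finset.sum_neg_distrib, mul_neg, map_mul,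
    Complex.conj_I, map_sum, Complex.conj_ofReal, neg_mul]

/-- **The divergence-free symbol relation** `∑ₗ ξₗ a₀(ξ)_l = 0` (`ξ · p = ξ · q = 0`). [folklore] -/
theorem sum_mul_datum (ξ : E3) : ∑ l, (ξ l : ℂ) * d.datum ξ l = 0 := by
  have hp := sum_mul_polP ξ
  have hq := sum_mul_polQ ξ
  have hpiece : ∀ s, ∑ l, ξ l * d.piece s ξ l = 0 := fun s => by
    have e : ∀ l, ξ l * d.piece s ξ l =
        d.α * d.bumpK s ξ * (ξ l * polP ξ l) + d.α * d.bumpK' s ξ * (ξ l * polQ ξ l) := fun l => by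
      rw [piece]; ring
    simp_rw [e, Finset.sum_add_distrib, ← Finset.mul_sum, hp, hq, mul_zero, add_zero]
  calc ∑ l, (ξ l : ℂ) * d.datum ξ l
      = Complex.I * ∑ s ∈ Finset.range d.r, ((∑ l, ξ l * d.piece s ξ l : ℝ) : ℂ) := by
        simp only [datum_apply, Complex.ofReal_sum, Complex.ofReal_mul, Finset.mul_sum]
        rw [Finset.sum_comm]
        refine Finset.sum_congr rfl fun s _ => Finset.sum_congr rfl fun l _ => ?_
        ring
    _ = 0 := by simp [hpiece]

/-- **Continuity of the datum.** [folklore] -/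
theorem continuous_datum : Continuous d.datum := by
  refine continuous_pi fun l => ?_
  simp only [datum_apply]
  refine continuous_const.mul (continuous_finsetSum _ fun s _ => ?_)
  exact Complex.continuous_ofReal.comp (d.contDiff_piece s l).continuous

/-- **Smoothness of the components of the datum.** [folklore] -/
theorem contDiff_datum_apply (l : Fin 3) : ContDiff ℝ ∞ fun ξ => d.datum ξ l := by
  simp only [datum_apply]
  refine contDiff_const.mul (ContDiff.sum fun s _ => ?_)
  exact (Complex.ofRealCLM.contDiff.comp (d.contDiff_piece s l))

/-- The radius `N_{r-1} + 2` of a ball containing the support of the datum (`2` if `r = 0`). [folklore] -/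
def suppRadius : ℝ := d.N (d.r - 1) + 2

/-- `0 < suppRadius`. [folklore] -/
theorem suppRadius_pos : 0 < d.suppRadius := by
  have := d.N_pos (d.r - 1); rw [suppRadius]; linarith

/-- **The datum vanishes outside the ball of radius `N_{r-1} + 2`.** [folklore] -/
theorem datum_eq_zero_of_le {ξ : E3} (h : d.suppRadius ≤ ‖ξ‖) : d.datum ξ = 0 := by
  ext l
  rw [datum_apply]
  have hz : ∀ s ∈ Finset.range d.r, (d.piece s ξ l : ℂ) = 0 := by
    intro s hs
    have hs' : s ≤ d.r - 1 := Nat.le_sub_one_of_lt (Finset.mem_range.1 hs)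
    have hN : d.N s ≤ d.N (d.r - 1) := d.N_mono hs'
    rw [d.piece_eq_zero (Or.inr ?_) l, Complex.ofReal_zero]
    rw [suppRadius] at h
    linarith
  rw [Finset.sum_eq_zero hz, mul_zero]
  rfl

/-- **Pointwise bound on the datum**: `‖a₀(ξ)‖ ≤ 4 α r (N_{r-1} + 2)`. [folklore] -/
theorem norm_datum_le (ξ : E3) : ‖d.datum ξ‖ ≤ 4 * d.α * d.r * d.suppRadius := by
  have hR := d.suppRadius_pos.le
  have hα := d.α_pos.le
  refine (pi_norm_le_iff_of_nonneg (by positivity)).2 fun l => ?_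
  rw [datum_apply, norm_mul, Complex.norm_I, one_mul]
  calc ‖∑ s ∈ Finset.range d.r, (d.piece s ξ l : ℂ)‖
      ≤ ∑ s ∈ Finset.range d.r, ‖(d.piece s ξ l : ℂ)‖ := norm_sum_le _ _
    _ ≤ ∑ _s ∈ Finset.range d.r, 4 * d.α * d.suppRadius := by
        refine Finset.sum_le_sum fun s hs => ?_
        rw [Complex.norm_real, Real.norm_eq_abs]
        refine (d.abs_piece_le' s ξ l).trans ?_
        have hs' : s ≤ d.r - 1 := Nat.le_sub_one_of_lt (Finset.mem_range.1 hs)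
        have hN : d.N s ≤ d.N (d.r - 1) := d.N_mono hs'
        rw [suppRadius]
        gcongr
    _ = 4 * d.α * d.r * d.suppRadius := by
        rw [Finset.sum_const, Finset.card_range, nsmul_eq_mul]; ring

/-- **Every polynomial decay of the datum** (compact support): with `R = N_{r-1} + 2`,
`HasDecay K (4 α r R (1 + R)^K) a₀`. [folklore] -/
theorem hasDecay_datum (K : ℕ) :
    HasDecay K (4 * d.α * d.r * d.suppRadius * (1 + d.suppRadius) ^ K) d.datum := by
  intro ξ
  have hR := d.suppRadius_pos.le
  have hα := d.α_pos.le
  by_cases h : d.suppRadius ≤ ‖ξ‖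
  · rw [d.datum_eq_zero_of_le h, norm_zero]
    positivity
  · push Not at h
    have hw : (1 : ℝ) ≤ (1 + d.suppRadius) ^ K * ((1 + ‖ξ‖) ^ K)⁻¹ := by
      rw [le_mul_inv_iff₀ (by positivity), one_mul]
      exact pow_le_pow_left₀ (by positivity) (by linarith) K
    calc ‖d.datum ξ‖ ≤ 4 * d.α * d.r * d.suppRadius := d.norm_datum_le ξ
      _ ≤ 4 * d.α * d.r * d.suppRadius * ((1 + d.suppRadius) ^ K * ((1 + ‖ξ‖) ^ K)⁻¹) :=
          le_mul_of_one_le_right (by positivity) hw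
      _ = _ := by ring

/-- The datum has decay of every order. [folklore] -/
theorem hasDecay_datum_all (K : ℕ) : ∃ B, HasDecay K B d.datum := ⟨_, d.hasDecay_datum K⟩

/-! ### The Fourier datum with viscosity `1` -/

/-- **The Bourgain–Pavlović datum as a `FourierDatum`** (viscosity `ν = 1`, explicit order-`4`
decay constant), the input of the tree's Fourier–Picard pipeline
(`FourierNS.FourierDatum.isTaoSolutionOn`: Leray's local regular solution from `synthVel a₀`,
restartable). [cite: BourgainPavlovic2008, Thm. 1.1 (the solution from the datum (3.1))] -/
def fourierDatum : FourierDatum (Fin 3) where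
  ν := 1
  hν := one_pos
  a := d.datum
  cont := d.continuous_datum
  decayAll := d.hasDecay_datum_all
  A := 4 * d.α * d.r * d.suppRadius * (1 + d.suppRadius) ^ (Fintype.card (Fin 3) + 1)
  decayA := d.hasDecay_datum _
  divFree := d.sum_mul_datum
  conjSymm := d.datum_conj_symm

/-- The viscosity is `1`. [folklore] -/
@[simp]
theorem fourierDatum_ν : d.fourierDatum.ν = 1 := rfl

/-- The datum of the `FourierDatum` is `a₀`. [folklore] -/
@[simp]
theorem fourierDatum_a : d.fourierDatum.a = d.datum := rfl

/-- The heat rate is `c = 4π²`. [folklore] -/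
theorem fourierDatum_c : d.fourierDatum.c = 4 * π ^ 2 := by
  simp [FourierDatum.c]

/-! ### The free evolution -/

/-- **The free (heat) evolution of the datum** on the Fourier side,
`U(t, ξ) = e^{-4π²‖ξ‖²t} a₀(ξ)` (`e^{tΔ}u₀` of Bourgain–Pavlović 2008, (3.4)). [cite: BourgainPavlovic2008, (3.4)] -/
def free (t : ℝ) (ξ : E3) : Fin 3 → ℂ := heat (4 * π ^ 2) ξ t • d.datum ξ

/-- Unfolding the free evolution. [folklore] -/
theorem free_apply (t : ℝ) (ξ : E3) : d.free t ξ = heat (4 * π ^ 2) ξ t • d.datum ξ := rfl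

/-- At `t = 0` the free evolution is the datum. [folklore] -/
@[simp]
theorem free_zero : d.free 0 = d.datum := by
  funext ξ; simp [free_apply]

/-- The free evolution is jointly continuous in `(t, ξ)`. [folklore] -/
theorem continuous_free : Continuous (uncurry d.free) := by
  change Continuous fun p : ℝ × E3 => heat (4 * π ^ 2) p.2 p.1 • d.datum p.2
  exact (continuous_heat_comp _ continuous_snd continuous_fst).smul
    (d.continuous_datum.comp continuous_snd)

/-- **Pointwise size of the free evolution**: `‖U(t,ξ)‖ ≤ ‖a₀(ξ)‖` for `t ≥ 0`. [folklore] -/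
theorem norm_free_le {t : ℝ} (ht : 0 ≤ t) (ξ : E3) : ‖d.free t ξ‖ ≤ ‖d.datum ξ‖ := by
  rw [free_apply, norm_smul, Real.norm_of_nonneg (heat_nonneg _ _ _)]
  exact mul_le_of_le_one_left (norm_nonneg _) (heat_le_one (by positivity) ht ξ)

/-- The free evolution vanishes where the datum does. [folklore] -/
theorem free_eq_zero_of_le {t : ℝ} {ξ : E3} (h : d.suppRadius ≤ ‖ξ‖) : d.free t ξ = 0 := by
  rw [free_apply, d.datum_eq_zero_of_le h, smul_zero]

end InflationParams

end Literature.Analysis.FluidPDE.BourgainPavlovic
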